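import Mathlib
import HarnessLib
import Summits.HubbardSuperconductivity.HubbardSuperconductivity.Theorems.KLProgrammeKLRegimeEngineValueClauseReductionV10
import Summits.HubbardSuperconductivity.HubbardSuperconductivity.Theorems.KLProgrammeKLRegimeEngineV8DefsG5

/-!
# K3 engine child, stub `stub_engine_step_values`: the IN-CLASS pair-value increment at the GAINS-RIDER package `klEngGeo5` —
# the package inequality of `klvr10_pairValueIncrement_inClass` HOLDS (`2^24·2^{-(n−1)} + 10·2^24 ≤ 2^28`)
# (cell gate-hubbard-kl, seat hubbard-kl-k3c2-p2 g6 «thermal-bar induction n ≤ nScales β + 1»; value-clause reduction lane)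

`…EngineValueClauseReductionV10` reduced the in-class (E2″-v6) inequality to (E2-v9) + `PairArrayAtV2 … (n−1)` + ONE package inequality
`G.aplus·G.ζ(n−1) + 10·G.bhi ≤ G.ppGain n |Qm|_𝕋`, which FAILS at `klEngGeo3/4` (pp gain capped at `1`, `bhi = 2^24`).  At the gen-6 package
`klEngGeo5 := klEngGeo4.scaleGains (2^28)` (`…EngineV8DefsG5`) it holds: in the pair class (`|Qm|_𝕋 ≤ 4^{-n}`) the pp profile
`ppGainOf 2^24 2^24 0 klE0 n n ρ` sits at its cap `1` (its Cooper term `2^24·Λ_n/ρ ≥ 2^19`), so `klEngGeo5.ppGain n |Qm|_𝕋 = 2^28 ≥ 11·2^24`.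

* `klg5_ppGainOf_eq_one_of_le` (`ρ ≤ 4^{-n} ⇒ ppGainOf … ρ = 1`), `klg5_ppGain_eq_of_isPairClassAt` (in class `klEngGeo5.ppGain n |Qm|_𝕋 = 2^28`),
  **`klg5_package_ineq_of_isPairClassAt`** (`klEngGeo5.aplus·klEngGeo5.ζ(n−1) + 10·klEngGeo5.bhi ≤ klEngGeo5.ppGain n |Qm|_𝕋`);
* **`klvr10_pairValueIncrement_inClass_klEngGeo5`**: at `n ≥ 1` and every in-class `Qm`, from (E2-v9) AT `klEngGeo5`, the history's `PairArrayAtV2 … (n−1)`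
  and the regime smallness `Klam ≥ 1`, `(C_W + klLegKappa·Q.CR·Klam³)|U| ≤ 1/10`, `|U|·2^24 ≤ 1/8`, the pair-value increment obeys the (E2″-v6) budget.

Arithmetic over the route's predicates and the package numerals; nothing about the model is asserted.
-/

noncomputable section

namespace Summit.HubbardSuperconductivity.HubbardSuperconductivity.Theorems.EngineV8

set_option linter.dupNamespace false -- summit = problem name (single-conjunct summit), D-0017

open Real Finset Literature.MathematicalPhysics.QuantumLattice Literature.Probability.LatticeModels
open Summit.HubbardSuperconductivity.HubbardSuperconductivity.Theorems.KLRegimeSplit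
open Summit.HubbardSuperconductivity.HubbardSuperconductivity.Theorems.KLProgrammeLegKernels

/-- In the pair class at resolution `n` (`ρ ≤ 4^{-n}`) the particle–particle profile of the package is at its cap:
`ppGainOf 2^24 2^24 0 klE0 n n ρ = 1` (for `ρ ≤ 0` by definition; for `0 < ρ ≤ 4^{-n}` the Cooper term `2^24·(klE0·4^{-n})/ρ ≥ 2^19 ≥ 1`). -/
theorem klg5_ppGainOf_eq_one_of_le {n : ℕ} {ρ : ℝ} (hρ : ρ ≤ ((4 : ℝ) ^ n)⁻¹) :
    ppGainOf (2 ^ 24) (2 ^ 24) 0 klE0 n n ρ = 1 := by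
  unfold ppGainOf
  simp only [zero_mul, sub_zero]
  split_ifs with h
  · have h4 : 0 < ((4 : ℝ) ^ n)⁻¹ := by positivity
    have ha : 1 ≤ 2 ^ 24 * (klE0 * ((4 : ℝ) ^ n)⁻¹) / ρ := by
      rw [le_div_iff₀ h, one_mul]
      calc ρ ≤ ((4 : ℝ) ^ n)⁻¹ := hρ
        _ ≤ 2 ^ 24 * (klE0 * ((4 : ℝ) ^ n)⁻¹) := by unfold klE0; nlinarith
    have hb : 0 ≤ (2 : ℝ) ^ 24 * Real.sqrt klE0 * ((2 : ℝ) ^ n)⁻¹ := by positivity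
    exact min_eq_left (by linarith)
  · rfl

variable {L : ℕ}

/-- **In class, `klEngGeo5.ppGain = 2^28`**: `IsPairClassAt L Qm n → klEngGeo5.ppGain n |Qm|_𝕋 = 2^28`. -/
theorem klg5_ppGain_eq_of_isPairClassAt {Qm : TorusSite 2 L} {n : ℕ} (hQm : IsPairClassAt L Qm n) :
    klEngGeo5.ppGain n (klTorusNorm L Qm) = 2 ^ 28 := by
  rw [klEngGeo5_ppGain_apply, klg5_ppGainOf_eq_one_of_le (ρ := klTorusNorm L Qm) hQm, mul_one]

/-- **The package inequality of `klvr10_pairValueIncrement_inClass` HOLDS at `klEngGeo5`** in the pair class: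
`aplus·ζ(n−1) + 10·bhi = 2^24·2^{-(n−1)} + 10·2^24 ≤ 2^28 = ppGain n |Qm|_𝕋`. -/
theorem klg5_package_ineq_of_isPairClassAt {Qm : TorusSite 2 L} (n : ℕ) (hQm : IsPairClassAt L Qm n) :
    klEngGeo5.aplus * klEngGeo5.ζ (n - 1) + 10 * klEngGeo5.bhi ≤ klEngGeo5.ppGain n (klTorusNorm L Qm) := by
  rw [klg5_ppGain_eq_of_isPairClassAt hQm]
  show (2 : ℝ) ^ 24 * ((2 : ℝ) ^ (n - 1))⁻¹ + 10 * 2 ^ 24 ≤ 2 ^ 28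
  have h1 : ((2 : ℝ) ^ (n - 1))⁻¹ ≤ 1 := inv_le_one_of_one_le₀ (one_le_pow₀ (by norm_num))
  nlinarith

variable [NeZero L] {M : ℕ} [NeZero M]

/-- **In-class (E2″-v6) AT THE PACKAGE `klEngGeo5`** — `klvr10_pairValueIncrement_inClass` with its package inequality discharged by
`klg5_package_ineq_of_isPairClassAt`: from (E2-v9) at `klEngGeo5`, the history's `PairArrayAtV2 … (n−1)` and the regime smallness
(`Klam ≥ 1`, `(C_W + klLegKappa·Q.CR·Klam³)|U| ≤ 1/10`, `|U|·2^24 ≤ 1/8`), the pair-value increment obeys the (E2″-v6) budget at every in-class `Qm`. -/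
theorem klvr10_pairValueIncrement_inClass_klEngGeo5 {P : SplitConsts} {Q : EngConsts} {β U μ : ℝ} {K : TrigPolyC4v} {n : ℕ}
    (hn : 1 ≤ n) (hlad : PairLadderStepAtV9 L M klEngGeo5 P Q β U μ K n) (harr : PairArrayAtV2 L M P Q β U μ K (n - 1))
    {Qm : TorusSite 2 L} (hQm : IsPairClassAt L Qm n) (hK : 1 ≤ P.Klam)
    (hcU : 0 ≤ P.C_W + klLegKappa * Q.CR * P.Klam ^ 3) (hcU' : (P.C_W + klLegKappa * Q.CR * P.Klam ^ 3) * |U| ≤ 1 / 10)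
    (hUb : |U| * 2 ^ 24 ≤ 1 / 8) :
    ∀ k ∈ klBall L μ K, ∀ k' ∈ klBall L μ K,
      ‖klPairAmplitude L M β U μ K n Qm k k' - klPairAmplitude L M β U μ K (n - 1) Qm k k'‖ ≤
        gainBar klEngGeo5 P U n (klTorusNorm L Qm) (klTorusNorm L (k - k')) (klTorusNorm L (k + k' - Qm)) +
          eremBar klEngGeo5 P Q U β L (n - 1) + thermalBar klEngGeo5 P U β n +
            legDressBarQ klEngGeo5 P Q U n (legSliceCountT L β μ K n ![k', Qm - k', Qm - k, k]) :=
  klvr10_pairValueIncrement_inClass hn hlad harr hQm hK (by norm_num [klEngGeo5_bhi, klEngGeo4_bhi, klEngGeo3_bhi]) hcU hcU'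
    (by rw [klEngGeo5_bhi, klEngGeo4_bhi, klEngGeo3_bhi]; exact hUb) (klg5_package_ineq_of_isPairClassAt n hQm)

end Summit.HubbardSuperconductivity.HubbardSuperconductivity.Theorems.EngineV8

end
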